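import Summits.NavierStokesRegularity.NavierStokesRegularity.Theorems.SelfMixingDichotomyMixingPayoffAdmissibleDriftHeatClass
import Summits.NavierStokesRegularity.NavierStokesRegularity.Theorems.SelfMixingDichotomyMixingPayoffAdmissibleMinPrinciple
import Summits.NavierStokesRegularity.NavierStokesRegularity.Theorems.SelfMixingDichotomyMixingPayoffDriftHeatBumpFloor
import Summits.NavierStokesRegularity.NavierStokesRegularity.Theorems.SelfMixingDichotomyMixingPayoffTypeIFloorAssembly
import HarnessLib

set_option linter.dupNamespace false

/-!
# Route SelfMixingDichotomy — crux `CoherentScaleExclusion` (stmt-NavierStokesRegularity-1423),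
# line `registered`, stub HF `stub_heatBumpFloor_allScales`: the pure-heat bump floor at every scale

Support file (`--supports stmt-NavierStokesRegularity-1423`) for the registered stub
`stub_heatBumpFloor_allScales` of the crux
`Summit.NavierStokesRegularity.NavierStokesRegularity.Theses.SelfMixingDichotomy.CoherentScaleExclusion`.

Write `S = [T − r², T − r²/2]` for the MIX window at scale `r > 0`. The route's MIX functional asks
whether every admissible passive scalar launched from a blob in `B(x₀, r)` loses all but a fraction
`δ` of its `L²` norm over `S`. This file records the PURE-HEAT floor at EVERY scale: there is a
universal `c > 0` such that every jointly smooth, uniformly rapidly decaying solution `θ` of the heat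
equation `∂ₜθ = Δθ` on `S × ℝ³` with bump datum (`0 ≤ θ(T − r²) ≤ 1`, `= 1` on `B̄(x₀, r/2)`,
supported in `B(x₀, r)`) keeps strictly more than the fraction `c²` of its `L²` mass:
`c² ∫ θ(T − r²)² < ∫ θ(T − r²/2)²`.

**Proof.** This is the assembly `stub_typeIFloorAssembly` / `kinWitness_typeICoherence_floor`
(files `…MixingPayoffTypeIFloorAssembly.lean`, `…CoherentScaleExclusionKinWitnessTypeICoherence.lean`)
run with the ZERO drift `u ≡ 0` and `K = 1`: the heat equation is the drift–heat equation
`∂ₜθ + ⟪u, ∇θ⟫ = Δθ` with `u = 0`; the drift bound `‖u‖ ≤ √2 · 1 / r` holds trivially on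
`S × ℝ³` (`U = univ`), so F1 `stub_admissibleDriftHeatClass` puts `θ` in the local drift–heat class
over `univ ⊇ B̄(x₀, 11 r)`, F2 `stub_admissibleMinPrinciple` gives `θ ≥ 0` on `S × ℝ³`, and F3
`stub_driftHeatBumpFloor 1` gives `θ(T − r²/2) ≥ λ` on `B̄(x₀, r/2)` with a universal `λ = λ(1) > 0`.
With `c := λ/3` the `L²` accounting `typeIFloor_integrable_sq_slice`,
`typeIFloor_integral_sq_le_of_bump`, `typeIFloor_le_integral_sq_of_floor` gives
`∫ θ(T − r²/2)² ≥ λ² |B̄(x₀, r/2)| = λ² |B₁| r³/8 > (λ/3)² |B₁| r³ ≥ c² ∫ θ(T − r²)²`.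
Neither `r² < T` nor a Type-I cylinder is needed: the floor holds at all scales `r > 0` and all `T`.

No named fact is taken as a hypothesis: everything below is unconditional (F1, F2, F3 and the
accounting lemmas are landed theorems of this namespace).
-/

noncomputable section

open Literature.Analysis.FluidPDE MeasureTheory Set Function Metric
open scoped ContDiff

namespace Summit.NavierStokesRegularity.NavierStokesRegularity.Theorems

/-- **HF — the pure-heat bump floor at every scale** (registered stub `stub_heatBumpFloor_allScales`
of the crux `CoherentScaleExclusion`, line `registered`). There is a universal `c > 0` (`c = λ(1)/3`,
`λ` from F3 `stub_driftHeatBumpFloor` at `K = 1`) such that for all `T`, all `r > 0`, all `x₀`, every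
jointly smooth, uniformly rapidly decaying solution `θ` of the heat equation `∂ₜθ = Δθ` on the window
`[T − r², T − r²/2] × ℝ³` with bump datum (`0 ≤ θ(T − r²) ≤ 1`, `θ(T − r²) = 1` on `B̄(x₀, r/2)`,
`supp θ(T − r²) ⊆ B(x₀, r)`) satisfies `c² ∫ θ(T − r²)² < ∫ θ(T − r²/2)²`. Proof adapted verbatim
from `kinWitness_typeICoherence_floor` (`…CoherentScaleExclusionKinWitnessTypeICoherence.lean`) with
the zero drift and `K = 1`: F1 over `U = univ` with the trivial drift bound `√2 · 1 / r`, F2, F3, then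
the `L²` accounting. -/
theorem stub_heatBumpFloor_allScales :
    ∃ c : ℝ, 0 < c ∧ ∀ (T r : ℝ) (x₀ : EuclideanSpace ℝ (Fin 3)), 0 < r →
      ∀ θ : ℝ → EuclideanSpace ℝ (Fin 3) → ℝ,
      IsSmoothSpaceTimeOn (Set.Icc (T - r ^ 2) (T - r ^ 2 / 2)) θ →
      HasUniformRapidDecayOn (Set.Icc (T - r ^ 2) (T - r ^ 2 / 2)) θ →
      (∀ t ∈ Set.Icc (T - r ^ 2) (T - r ^ 2 / 2), ∀ x : EuclideanSpace ℝ (Fin 3),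
        timeDerivWithin (Set.Icc (T - r ^ 2) (T - r ^ 2 / 2)) θ t x = Laplacian.laplacian (θ t) x) →
      (∀ x, 0 ≤ θ (T - r ^ 2) x) → (∀ x, θ (T - r ^ 2) x ≤ 1) →
      (∀ x ∈ Metric.closedBall x₀ (r / 2), θ (T - r ^ 2) x = 1) →
      Function.support (θ (T - r ^ 2)) ⊆ Metric.ball x₀ r →
      c ^ 2 * ∫ x, (θ (T - r ^ 2) x) ^ 2 < ∫ x, (θ (T - r ^ 2 / 2) x) ^ 2 := by
  -- adapted from `kinWitness_typeICoherence_floor`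
  -- (Theorems/SelfMixingDichotomyCoherentScaleExclusionKinWitnessTypeICoherence.lean) and its parent
  -- `stub_typeIFloorAssembly` (Theorems/SelfMixingDichotomyMixingPayoffTypeIFloorAssembly.lean):
  -- the same assembly with the zero drift and `K = 1`; no Type-I cylinder, no `r² < T`.
  -- the constant: a third of the Gaussian floor `λ(1)` of F3
  obtain ⟨lam, hlam, hfloor⟩ := stub_driftHeatBumpFloor 1 one_pos
  refine ⟨lam / 3, by positivity, ?_⟩
  intro T r x₀ hr θ hsm hdec hpde hθ0 hθ1 hone hsupp
  -- the zero drift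
  set u : ℝ → EuclideanSpace ℝ (Fin 3) → EuclideanSpace ℝ (Fin 3) := fun _ _ => 0 with hu
  -- (o) the heat equation is the drift–heat equation with the zero drift
  have hpde' : ∀ t ∈ Set.Icc (T - r ^ 2) (T - r ^ 2 / 2), ∀ x : EuclideanSpace ℝ (Fin 3),
      timeDerivWithin (Set.Icc (T - r ^ 2) (T - r ^ 2 / 2)) θ t x
          + inner ℝ (u t x) (gradient (θ t) x)
        = Laplacian.laplacian (θ t) x := by
    intro t ht x
    rw [hu, inner_zero_left, add_zero]
    exact hpde t ht x
  -- (i) the zero drift is continuous on `S × ℝ³`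
  have hcont : ContinuousOn (Function.uncurry u)
      (Set.Icc (T - r ^ 2) (T - r ^ 2 / 2) ×ˢ Set.univ) := continuousOn_const
  -- (ii) the (trivial) drift bound `√2 · 1 / r` on `S × univ`
  have hbound : ∀ t ∈ Set.Icc (T - r ^ 2) (T - r ^ 2 / 2),
      ∀ x ∈ (Set.univ : Set (EuclideanSpace ℝ (Fin 3))), ‖u t x‖ ≤ Real.sqrt 2 * 1 / r := by
    intro t _ x _
    rw [hu, norm_zero]
    positivity
  -- (iii) F1: membership in the local drift–heat class over `U = univ`
  obtain ⟨a, ha⟩ :=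
    stub_admissibleDriftHeatClass T r u θ hr hcont hsm hpde' (Real.sqrt 2 * 1 / r) Set.univ hbound
  -- (iv) F2: nonnegativity on the window
  have hpos : ∀ t ∈ Set.Icc (T - r ^ 2) (T - r ^ 2 / 2), ∀ x : EuclideanSpace ℝ (Fin 3),
      0 ≤ θ t x :=
    stub_admissibleMinPrinciple T r u θ hr hsm hdec hpde' hθ0
  -- (v) F3 (with `K = 1`): the floor `λ` on `B̄(x₀, r/2)` at the final time
  have hlow : ∀ x ∈ Metric.closedBall x₀ (r / 2), lam ≤ θ (T - r ^ 2 / 2) x :=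
    hfloor a θ x₀ T r hr Set.univ isOpen_univ (Set.subset_univ _) ha hpos hone
  -- (vi) integrability of the final squared slice
  have hr2 : 0 < r ^ 2 := by positivity
  have htS : T - r ^ 2 / 2 ∈ Set.Icc (T - r ^ 2) (T - r ^ 2 / 2) := ⟨by linarith, le_rfl⟩
  have hint : Integrable (fun x => (θ (T - r ^ 2 / 2) x) ^ 2) :=
    typeIFloor_integrable_sq_slice hsm hdec htS
  -- (vii) the `L²` accounting
  set V : ℝ := (volume : Measure (EuclideanSpace ℝ (Fin 3))).real
      (Metric.ball (0 : EuclideanSpace ℝ (Fin 3)) 1) with hV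
  have hV0 : 0 < V := by
    rw [hV, measureReal_def]
    exact ENNReal.toReal_pos (measure_ball_pos volume _ one_pos).ne' measure_ball_lt_top.ne
  have hI0 : ∫ x, (θ (T - r ^ 2) x) ^ 2 ≤ r ^ 3 * V :=
    typeIFloor_integral_sq_le_of_bump hr.le hθ0 hθ1 hsupp
  have hI1 : lam ^ 2 * ((r / 2) ^ 3 * V) ≤ ∫ x, (θ (T - r ^ 2 / 2) x) ^ 2 :=
    typeIFloor_le_integral_sq_of_floor hr.le hlam.le hint hlow
  have hgap : 0 < lam ^ 2 * (r ^ 3 * V) := by positivity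
  calc (lam / 3) ^ 2 * ∫ x, (θ (T - r ^ 2) x) ^ 2 ≤ (lam / 3) ^ 2 * (r ^ 3 * V) :=
        mul_le_mul_of_nonneg_left hI0 (sq_nonneg _)
    _ < lam ^ 2 * ((r / 2) ^ 3 * V) := by nlinarith
    _ ≤ ∫ x, (θ (T - r ^ 2 / 2) x) ^ 2 := hI1

end Summit.NavierStokesRegularity.NavierStokesRegularity.Theorems

end
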